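import Mathlib
import HarnessLib
import HarnessLib.Audit
import Summits.AtomisticToContinuum.Statement
import Literature.MathematicalPhysics.QuantumManyBody.PeriodicBoseGas
import HarnessLib.Audit.Status.Attr

/-!
Route: BECSectorPoincare

CLOSED (retired) 2026-08-15T13:40:21Z by operator:999:1257524 — reason: not-a-thesis: assembly does not conclude the sub-problem Statement — note: D-0027 §2.1 audit (human 2026-08-15: routes that do not decide the summit are removed): the assembly concludes `Literature.MathematicalPhysics.QuantumManyBody.BoseGas.BoseEinsteinCondensation`, not the sub-problem statement; a NEW conforming route may be opened from the same idea (generated `closes . The file is kept as the record of this route; refuted decls are indexed as negative knowledge (`ledger negatives`).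

# Route BECSectorPoincare — Feynman's k²/S(k) as a lower bound — Landau's sector bound as a
sectorial Poincaré inequality via two-scale convexification, then BEC by the moment sum rule

It suffices to show X = LANDAU'S SECTOR BOUND ON THE TORUS (card sector-poincare-two-scale, its
(SP_k)/(L) in min–max form,
no ground-state object needed): for every repulsive finite-range v and every window multiple M₀
there are θ, ρ₀ > 0 such that
for 0 < ρ < ρ₀, all large N, every box L in the density window ρ/2 ≤ N/L³ ≤ 2ρ and every
dual-lattice momentum k = (2π/L)m,
m ≠ 0, |k| ≤ M₀√(ρa) (a = scattering length), EVERY Bloch-k periodic trial state Ψ (Ψ(X+s) =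
e^(ik·s)Ψ(X)) has
periodicEnergy ≥ E₀^per(N,L) + θ√(ρa)|k| — the bottom of the momentum-k sector lies above a linear
cone with slope ∝ sound
speed, uniformly in N. In the ground-state representation this is exactly a momentum-resolved
Poincaré inequality for
μ = Ψ₀²dX (Feynman's ρ_kΨ₀ gives the UPPER value k²/S(k)); the card's mechanism is to prove it as a
LOWER bound by a
sector-resolved two-scale (multiscale Bakry–Émery) convexification with hyperuniform curvature. X ⇒
PeriodicBEC by the
Wagner–Feynman moment bound + mode counting (torus), then the shared transfer crux 0827 gives the
conjunct.
Lean: `∀ v : ℝ → ENNReal,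
Literature.MathematicalPhysics.QuantumManyBody.BoseGas.IsRepulsiveFiniteRange v → ∀ M₀ : ℝ, 0 < M₀ →
∃ θ : ℝ, 0 < θ ∧ ∃ ρ₀ : ℝ, 0 < ρ₀ ∧ ∀ ρ : ℝ, 0 < ρ → ρ < ρ₀ → ∀ᶠ N : ℕ in Filter.atTop, ∀ L : ℝ, 0 <
L → ρ / 2 ≤ (N : ℝ) / L ^ 3 → (N : ℝ) / L ^ 3 ≤ 2 * ρ → ∀ m : Fin 3 → ℤ, m ≠ 0 → let a : ℝ :=
(Literature.MathematicalPhysics.QuantumManyBody.BoseGas.scatteringLength v).toReal; let k : ℝ := 2 *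
Real.pi / L * ‖(WithLp.toLp 2 fun t => (m t : ℝ) : EuclideanSpace ℝ (Fin 3))‖; k ≤ M₀ * Real.sqrt (ρ
* a) → ∀ Ψ : Literature.MathematicalPhysics.QuantumManyBody.BoseGas.PeriodicTrialState N L, (∀ (X :
Literature.MathematicalPhysics.QuantumManyBody.BoseGas.Config N) (s : EuclideanSpace ℝ (Fin 3)), Ψ.ψ
(fun j => X j + s) = Complex.exp (Complex.I * ↑(2 * Real.pi / L * ∑ t : Fin 3, (m t : ℝ) * s t)) *
Ψ.ψ X) → Literature.MathematicalPhysics.QuantumManyBody.BoseGas.periodicGroundStateEnergy v N L +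
ENNReal.ofReal (θ * Real.sqrt (ρ * a) * k) ≤
Literature.MathematicalPhysics.QuantumManyBody.BoseGas.periodicEnergy v Ψ`

## Assembly
Pure logic, sorry-free in Sketch.lean (theorem assembly_holds, axioms
propext/Classical.choice/Quot.sound):
fun hTS hHU hC hB hT v hv => hT v hv (hB v hv (hC v hv) (hTS v hv (hHU v hv))) — hyperuniformity and
the two-scale reduction give X for v
(theorem target_of_cruxes : TwoScaleReduction → TorusHyperuniformity → LandauSectorBound),
near-convexity + X give PeriodicBEC(v) by the
bridge, and BoundaryTransferWeak (0827) turns PeriodicBEC(v) into HasGroundStateBEC v ρ for small ρ,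
i.e. the conjunct
(BoseEinsteinCondensation is Literature…BoseGas.BoseEinsteinCondensation by rfl).

Rationale: WHY THIS LINE. Ground-state transform: H − E₀ on bosonic momentum sectors is the Dirichlet form
∫Σ_i|∇_iF|²Ψ₀² on Bloch-k functions, so Landau's
criterion is a functional inequality for ONE probability measure, and Feynman1954's k²/2mS(k) —
seventy years an upper bound (Stringari1995
§2, PitaevskiiStringari1991) — is the Otto-calculus rate "conservative mobility ρk² × hyperuniform
curvature 1/(ρS(k))"; the bet is that the
two-scale / multiscale Bakry–Émery technology that gave size-uniform gaps and LSI to non-convex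
conservative systems (GrunewaldEtAl2009,
OttoReznikoff2007, MenzOtto2013, LuYau1993; Fourier-native along an exact RG flow:
BauerschmidtDagallier2023, BauerschmidtBodineauDagallier2024)
turns hyperuniformity S(k) ≤ C|k|/√(ρa) (ReattoChester1967; the T = 0 signature) into the LOWER
bound θ√(ρa)|k| ≤ ω_L(k), i.e. Feynman is
sharp up to a constant on the phonon window. Imported areas: functional inequalities for Gibbs
measures / optimal-transport calculus
(probability), used on the excitation spectrum of a quantum fluid — a pairing not found in the
searched literature; downstream only
Wagner1966/Stringari1995 sum rules and the d = 3 mode count. What prior routes do not do: every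
gap-based route (barrier
KineticGapLengthScales) uses the GLOBAL box gap ~L⁻²; here the gap is SECTOR-RESOLVED (c|k| in
sector k, only |k| ≥ 2π/L needed) and E₀ is
removed exactly by the transform, so no energy-localisation bookkeeping enters; BECSwapOverlap and
card sector-gap-no-cheap-momentum CONSUME a
Landau-type floor, this route PRODUCES it. Negatives index empty at filing.

RANKED CRUXES. #0 LandauSectorBound (target) — X as in § Thesis: linear sector floor θ√(ρa)|k| for
all Bloch-k periodic trial states, 2π/L ≤ |k| ≤ M₀√(ρa), density window ρ/2..2ρ, all large N (θ
after M₀; hard cores admitted; a = 0 makes it trivially true). (why it might fail: A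
thermodynamic-limit spectral statement (only MF/GP sector spectra are theorems: Seiringer2011,
BoccatoEtAl2019Acta); a soft non-phonon branch or c.o.m. tower inside |k| ≤ M₀√(ρa), or θ→0 with L,
kills it (the Jones–Roberts ring branch undercuts c|k| only at |k| ≳ C/a, outside the window).)
[Feynman1954, Stringari1995, Seiringer2011, BoccatoEtAl2019Acta, JonesRoberts1982, LiebLiniger1963]
#2 TwoScaleReduction (crux) — (card TS + HC, specialised and typed as an implication) for each
admissible v: TorusHyperuniformity's body for v ⇒ LandauSectorBound's body for v — hyperuniformity
of the near-ground states upgrades, by a SECTOR-RESOLVED two-scale/multiscale Bakry–Émery argument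
for μ = Ψ₀² (local dilute-gas block Poincaré at scales ≤ O(ξ), coarse convexity of
−log(block-density law) with modulus ≍ 1/(ρS(k)), Fourier-block-diagonal cross terms), to the linear
sector floor: "Feynman's k²/S(k) is a lower bound up to a constant". [difficulty: open-problem] (why
it might fail: Cross-scale terms for Ψ₀² are as long-ranged as the 1/|k| stiffness itself; S(k) ≤ Ck
is only the Gaussian shadow of the coarse convexity actually needed, and conditional block gaps of
Ψ₀² are unknown; kill signal: the scheme returns only the global gap ~c/L.) [GrunewaldEtAl2009,
OttoReznikoff2007, MenzOtto2013, BauerschmidtBodineauDagallier2024, BauerschmidtDagallier2023,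
LuYau1993, ReattoChester1967]
#3 TorusHyperuniformity (crux) — (card HC, quantitative half; torus twin of
stmt-AtomisticToContinuum-3978) for every admissible v and M₀ there are C, ρ₀ with: for 0 < ρ < ρ₀,
all large N, every L in the density window there is δ > 0 such that every δ-near-minimiser Ψ of the
periodic energy has Var_(|Ψ|²)(Σ_j e^(ik·x_j)) ≤ C·N·|k|/√(ρa) for all k = (2π/L)m, m ≠ 0, |k| ≤
M₀√(ρa) (S(k) ≤ C|k|/√(ρa) down to the lowest mode; Bogoliubov: C → 1/(4√π); necessary for X by
Feynman–Bijl). [difficulty: XL] (why it might fail: Uniformity down to |k| = 2π/L for all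
near-minimisers needs an LHY-precision LOWER bound for H + λΣcos(k·x_i) (static response χ(k) ≤
C/(ρa)) that is not in print; C may need ρ- or M₀-dependence beyond Bogoliubov; the canonical
constraint could spoil the lowest shell.) [ReattoChester1967, PitaevskiiStringari1991,
TorquatoStillinger2003, FournaisSolovej2020, Stringari1995]
#5 BoundaryTransferWeak (crux) — (= BECPeriodicReduction.BoundaryTransferWeak, item
stmt-AtomisticToContinuum-0827, verbatim; shared) for each admissible v, PeriodicBEC(v) implies ∃ρ₀
> 0 ∀ρ ∈ (0,ρ₀) HasGroundStateBEC v ρ (Dirichlet, mode-free). [deps: LandauToPeriodicBEC]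
[difficulty: XL] (why it might fail: PeriodicBEC(v) is ground-state-only at the box (N/ρ)^(1/3): the
Dirichlet ground state lies a wall term ≫ δ above E₀^per and interior restrictions are neither
periodic nor of sharp N, so the hypothesis may never fire; BEC is BC-sensitive (Robinson1976).)
[LSSY2005, Basti2022, BoccatoSeiringer2023, Junge2026, Robinson1976, LauwersVerbeureZagrebnov2003]
#6 EnergyConvexityWindow (crux) — (needed by the moment bound because a_k changes N) near-convexity
of the canonical torus energy in N in the dilute window: for each admissible v there is ρ₁ such that
for every ε > 0, 0 < ρ < ρ₁, all large N and L in the density window, 2E₀^per(N,L) ≤ E₀^per(N+1,L) +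
E₀^per(N−1,L) + ε√(ρa)/L (expected: second difference = +8πa/L³(1+o(1)) ≥ 0, allowance ε√(ρa)/L ≫
a/L³). [difficulty: M] (why it might fail: No proof of convexity of N ↦ E₀(N,L) at fixed L is known
for continuum bosons (LHY-precision asymptotics FournaisSolovej2020/LSSY2005 miss second differences
by orders); packing/commensurability could make increments non-monotone for hard cores before the
dilute asymptotics set in.) [LSSY2005, FournaisSolovej2020, LiebLiniger1963, BoccatoEtAl2019]
#9 LandauToPeriodicBEC (support) — (bridge, now a COROLLARY at the junction with
route-AtomisticToContinuum-BECSectorGap: glue LandauFloorToSectorGap + their HardCoreMomentBound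
5150, ZeroMomentumGround 5151, MomentBoundCondensation 5152, FreeGasCondensation 5153, by trichotomy
on ∫v — theorem landauToPeriodicBEC_of_sectorGapRoute in Sketch.lean; card BR = card
sector-gap-no-cheap-momentum N2+N3 with the N±1 correction) for each admissible v:
EnergyConvexityWindow's body for v ⇒ LandauSectorBound's body for v ⇒ PeriodicBEC's body for v
(stmt-0826): the Wagner–Feynman moment bound n_k(ω_(N−1)(k) + ω_(N+1)(k) + μ⁺ − μ⁻) ≤
⟨[a_k,[H,a_k†]]⟩ ≤ k² + 2ρv̂(0) for the torus ground state (P = 0 by uniqueness/positivity), the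
floor at N±1 in the same box (density window), near-convexity to absorb μ⁺ − μ⁻, kinetic Chebyshev
above K = M₀√(ρa) with M₀² ≥ 2v̂(0)/a and E₀ ≤ ½ρv̂(0)N, the d = 3 count
Σ_(0<|k|≤K)(k²+2ρv̂)/(θ√(ρa)|k|) ≤ C√(ρa³)N, then transfer to δ-near-minimisers at fixed (N,L); c =
1/2. [difficulty: M] [Wagner1966, Stringari1995, PitaevskiiStringari1991, Roepstorff1978, LSSY2005]
#9 LandauFloorToSectorGap (support) — (glue, junction with route-AtomisticToContinuum-BECSectorGap)
for each admissible v: EnergyConvexityWindow's body → LandauSectorBound's body → the tail of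
BECSectorGap.SectorGapFloor (stmt-5149: ∫v ≠ 0 → ∀ C > 0 ∃ κ, ρ₀: Γ_N(k) = E^per_(N+1)(k;L) +
E^per_(N−1)(k;L) − 2E₀^per(N,L) ≥ 2κ‖k‖² for k ≠ 0, ‖k‖² ≤ Cρ, L = (N/ρ)^(1/3)); proof: 0 < a < ∞,
M₀ := √(C/a), κ := θ√(a/C)/2, empty Bloch classes off the dual lattice, the Landau body at N±1 in
the same box, near-convexity with ε := πθ. [difficulty: provable-now] [LSSY2005, Stringari1995]
#9 GPWindowSectorGap (support) — (card LB, torus shadow; calibration of the local input) for every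
admissible v and M there are θ, ℓ₀ with: for ℓ ≥ ℓ₀ and n·a ≤ M²ℓ (Gross–Pitaevskii window and
below), every Bloch-k periodic trial state of n particles on the torus of side ℓ, k ≠ 0, has
periodicEnergy ≥ E₀^per(n,ℓ) + θ/ℓ² (Bogoliubov: gap ≈ √((2π)⁴ + 16π(na/ℓ)(2π)²)/ℓ²; a corollary of
the BBCS spectrum for V ∈ L³ at fixed na/ℓ, plus n₊ ≥ 1 on k ≠ 0 sectors; open for hard cores).
[difficulty: L] [BoccatoEtAl2019Acta, BoccatoEtAl2019, LSSY2005, NamEtAl2022]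
#9 ScatteringLengthFinite (support) — (shared support, verbatim from sibling routes) finite range ⇒
scatteringLength v ≠ ⊤ (a ≤ R₀ + ε by the trial φ = 0 on B_R₀, = 1 off B_(R₀+ε); ⊤·0 = 0 for hard
cores); wanted by the bridge prover. [difficulty: provable-now] [LSSY2005]

TWO-LAYER PLAN. JUNCTION (2026-08-15, after open): route-AtomisticToContinuum-BECSectorGap (card
sector-gap-no-cheap-momentum) consumes exactly what this route produces — its rank-2 crux
SectorGapFloor (particle–hole form, stmt-5149) follows from LandauSectorBound +
EnergyConvexityWindow by the glue LandauFloorToSectorGap, and its supports 5150–5153 turn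
SectorGapFloor into the PeriodicBEC body, so LandauToPeriodicBEC here is a corollary (support).
Foreseen glued split of TwoScaleReduction once definitions land (k = 3, depth 1): TwoScaleReduction
⇐ LocalConditionalGap (Poincaré
constant ≥ c·min(ℓ⁻², √(ρa)/ℓ) for the law of the particles in a cube of side ℓ ≤ Cξ given the
exterior, uniformly on good exteriors —
the conditioned twin of GPWindowSectorGap) → CoarseDensityWaveConvexity (uniform convexity of −log
P(block densities) along waves of
wavevector k with modulus κ(k) ≥ c/(ρS(k)), the structural half of card HC) → SectorTwoScaleLemma
(abstract, measure-theoretic: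
translation-invariant μ on (T³_L)^N, conservative Dirichlet form, (a)+(b) ⇒ sector-k gap ≥
(1−ε)min(λ_ℓ, ρk²κ(k)); to be posed
Fourier-natively as a Polchinski-flow criterion per BauerschmidtBodineauDagallier2024) →
TwoScaleReduction. Foreseen split of
LandauToPeriodicBEC: MomentBound (exact GS, integrable v) → ModeCount (pure lattice-sum arithmetic,
provable now) → NearMinimiserTransfer.
TorusHyperuniformity ⇐ SchwarzToResponse (S ≤ |k|√(χ/N)) → StaticResponseBound (χ_N(k)/N ≤ C/(ρa)
from an LHY-precision cos-probe
lower bound), shared with BECSwapAffinity's 3978 line.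

KILL CRITERIA. ¬LandauSectorBound for some admissible v at arbitrarily small ρ (a soft sector inside
the phonon window: tower or non-phonon branch)
closes the route `refuted:LandauSectorBound` and is major negative knowledge for BECSwapOverlap /
card sector-gap-no-cheap-momentum too.
¬TorusHyperuniformity refutes X as well (Feynman–Bijl: X ⇒ S(k) ≤ |k|/(θ√(ρa)) for the ground state)
— close. ¬TwoScaleReduction cannot
be refuted without refuting X (it is an implication with a true-or-open hypothesis); its practical
death is the kill signal "only the global
gap c/L comes out", recorded as a census, then pivot to the Polchinski-flow form or close
`exhausted`. ¬EnergyConvexityWindow forces a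
pivot of the bridge to an N-conserving test operator (a₀†a_k) or to the density channel + a vertex
crux; ¬LandauToPeriodicBEC for hard cores
only ⇒ restate the bridge for integrable v and add a hard-core softening item. PeriodicBEC (0826)
proved elsewhere moots ranks 4–6 but not
X (X stays wanted by the swap-overlap line); BoundaryTransferWeak refuted kills every torus route's
last step, not X.

NOT DECOMPOSED YET. The abstract SectorTwoScaleLemma and its two inputs (need definitions D1–D3
below; layer-2 children of TwoScaleReduction); the
equivalence (L) ⇔ sectorial Poincaré for μ = Ψ₀² (textbook ground-state transform, AHKS 1977 — needs
a ground-state object and D1;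
provers of rank 2 do it inline); constants θ, C versus Bogoliubov's 4√π and 1/(4√π); the a = 0 /
v̂(0) = ∞ special cases of the bridge;
the fixed-(N,L) near-minimiser transfer (compact resolvent on the torus) shared with the positivity
routes; d = 1, 2 analogues (X expected
true in d = 1 by LiebLiniger1963 type-I branch at small k — consistent, the mode count fails there,
PitaevskiiStringariOneDimension).

CHEAPEST FALSIFIER. (i) Bogoliubov consistency is an identity (k²/S(k) = e(k) ≥ 4√(πρa)|k|;
multi-phonon states cost ≥ c Σ|q_i| ≥ c|k|) — passed on paper.
(ii) The vortex-ring / Jones–Roberts branch: E/P → 0 along rings, undercutting any linear floor at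
total momentum P ≳ C(θ)/a·polylog —
this FIXED the window |k| ≤ M₀√(ρa) ≪ 1/a in X (checked on paper: R/ξ = √(4|k|a/π) → 0 on the
window). (iii) kit (not run here, hub
compute is async): VMC-optimised Jastrow–Bogoliubov |Ψ|² for N ~ 10³ soft spheres, Rayleigh quotient
of the GS diffusion over
F ∈ span(ρ_k, ρ_(k−q)ρ_q) in the lowest sectors vs L — two-phonon F undercutting k²/S(k) by a factor
growing with L falsifies X for that
state; (iv) exact diagonalisation of ≤ 8 lattice bosons on 3-D tori: ω_L(k)/|k| and E_(N+1) − 2E_N +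
E_(N−1) vs L at fixed filling
(EnergyConvexityWindow sign check). (v) Lookup: a GOVW/BBD-type lemma with k-dependent divergent
curvature in the Gaussian caricature
(GFF with covariance |k| plus local quartic) — if even there block inputs cannot return the sector
gap, rank 2 needs the flow form at once.

NUMBERS. Bogoliubov (ħ = 2m = 1): e(k) = √(k⁴ + 16πρa k²) ≥ 4√π·√(ρa)|k|, so θ ≤ 4√π ≈ 7.09; S(k) =
k²/e(k) ≤ |k|/(4√(πρa)), C ≥ 1/(4√π) ≈ 0.141;
healing length ξ = (8πρa)^(−1/2); chemical potential 8πρa, second difference 8πa/L³; bridge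
bookkeeping: UV tail ≤ N v̂(0)/(2M₀²a) ≤ N/4 for
M₀² ≥ 2v̂(0)/a (v̂(0) = ∫v ≥ 8πa, Spruch–Rosenberg), IR sum ≤ N√(ρa³)(M₀⁴/4 + M₀²v̂(0)/a)/(4π²θ) →
0, hence c = 1/2. Vortex ring:
E/P = 2 ln(8R/ξ)/R with R = √(P/(2π²ρ)), below the phonon slope √2/ξ once R ≫ ξ, i.e. P ≫ 1/a
(JonesRoberts1982). Rigorous sector spectra:
GP window only (BoccatoEtAl2019Acta: Σn_p√(p⁴+16π𝔞p²) + O(N^(−1/4))). Items: 10 (4 cruxes, 1 target,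
4 support, 1 assembly) after the junction edit.

DEFINITION REQUESTS. D1 GroundStateDirichletForm (filed with this route): for a symmetric C¹
periodic Ψ on the N-particle cell and a test function F, the
form E_Ψ(F) = ∫_cell Σ_i |∇_(x_i) F|² |Ψ|² dX and the Bloch-k test class — makes the
sectorial-Poincaré reformulation of X typable and is
wanted by cards sector-gap-no-cheap-momentum (N4) and parent-hamiltonian-anchor. Foreseen, NOT filed
until rank 2 is claimed: D2 block-density
coarse-graining + conditional block laws of |Ψ|² (Mathlib condKernel over cellOccupation-type
counts); D3 "uniform convexity along density
waves" of the coarse-grained functional. Cite facts wanted later (not load-bearing now): BBCS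
excitation spectrum in the GP regime
(BoccatoEtAl2019Acta Thm 1.1) as a named fact for GPWindowSectorGap.

Novelty: Searches (2026-08-15, this seat; searchd reset once, OpenAlex/arXiv HTTP 429, galaxy queue saturated
twice — recorded in NOTES): `lit frontier
AtomisticToContinuum --since 2021` (30 rows; BEC descendants arXiv:2603.20776, arXiv:2510.20493,
arXiv:2602.16566 — all kinetic-gap
localisation); `lit bridges AtomisticToContinuum --cross any` (no Bose-gas/functional-inequality
bridge); `lit search --source crossref` ×4
("Feynman formula lower bound excitation spectrum Bose gas structure factor spectral gap" → Lieb1963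
doi:10.1103/physrev.130.1616,
Bhattacharyya–Woo 1973; "Kawasaki dynamics beyond the uniqueness threshold spectral gap log-Sobolev
multiscale" → doi:10.1007/s00440-024-01326-9,
LuYau1993, Cancrini–Martinelli–Roberto 2002, Barthe–Milman doi:10.1007/s00220-013-1782-2; "two-scale
logarithmic Sobolev canonical ensemble"
→ GrunewaldEtAl2009, MenzOtto2013, OttoReznikoff2007, Lelièvre doi:10.1016/j.jfa.2008.09.019;
"solitary waves vortex rings energy momentum"
→ JonesRoberts1982); `lit vsearch` (sector lower bound / GS diffusion gap: 8 textbooks only —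
LSSY2005, Stringari in
book:griffin1995-bose-einstein-condensation pp. 76–80, Benedikter–Porta–Schlein 2016); zbMATH/S2 0
relevant; plus the card's and audits 7/13/15
searches (inherited, ids in the card).
Nearest prior art found: BauerschmidtBodineauDagallier2024 (doi:10.1007/s00440-024-01326-9: gap/LSI
for CONSERVATIVE lattice dynamics by
multiscale Bakry–Émery — the engine, spins not particles, no sectors); GrunewaldEtAl2009  [refs: 10.1103/physrev.130.1616, 10.1007/s00440-024-01326-9, 10.1007/s00220-013-1782-2, 10.1016/j.jfa.2008.09.019, 10.1007/s00440-024-01326-9:, 2603.20776, 2510.20493, 2602.16566, doi:10.1103/physrev.130.1616, doi:10.1007/s00440-024-01326-9, doi:10.1007/s00220-013-1782-2, doi:10.1016/j.jfa.2008.09.019, book:griffin1995-bose-einstein-condensation, Lieb1963, LuYau1993, GrunewaldEtAl2009, MenzOtto2013, Otto]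

Barriers (technique_class: functional-inequality, two-scale-lsi, sum-rules): - technique_class: functional-inequality, two-scale-lsi, sum-rules
- Literature.Barriers.AtomisticToContinuum.KineticGapLengthScales: met head-on and evaded by SECTOR
RESOLUTION — no step "depletion ≤ L² × excess energy": the transform removes E₀ exactly, the gap
used in sector k is that sector's own c|k| (only |k| ≥ 2π/L needed) and each mode pays 1/ω_L(k) in a
sum convergent in d = 3; honest: the barrier re-enters if a proof of rank 2 localises the
Hamiltonian in space instead of the Dirichlet form (kill signal "global gap c/L only").
- Literature.Barriers.AtomisticToContinuum.BogoliubovPerturbationInfrared: evaded — no expansion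
around a Bogoliubov state; Bogoliubov appears only as the Gaussian case curvature = inverse
covariance; the d = 3 marginal logs would surface in κ(k) or in the cross-scale terms of rank 2
(flagged there), not in a divergent series.
- Literature.Barriers.AtomisticToContinuum.EnergyAsymptoticsWithoutCondensation: respected — no
energy asymptotics are used (E₀ enters the bridge only through E₀ ≤ ½ρv̂(0)N); inputs are spectral
(sector floors) and structural (hyperuniformity, convexity).
- Literature.Barriers.AtomisticToContinuum.HalfFillingReflectionPositivity: evaded — the infrared
bound n_k ≤ (k²+2ρv̂)/(2ω_L(k)) comes from a sector gap and a CCR double commutator, not from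
Gaussian domination; no lattice, no particle–hole symmetry.
- Literature.Barriers.AtomisticToContinuum.PitaevskiiStringariOneDimension: respected and used as
calibration — X and th

History (route lifecycle, newest last):
- 2026-08-15T13:40:21Z · CLOSED retired — not-a-thesis: assembly does not conclude the sub-problem Statement (operator:999:1257524)

sub-problem: BoseEinsteinCondensation · status: closed(retired) · opened planner-plancard-AtomisticToContinuum-BoseEin-9149075b-0 2026-08-15T11:45:51Z · rev 0 · ledger route-AtomisticToContinuum-BECSectorPoincare
GENERATED by the gate from the ledger (D-0016/17). Provers cite these decls: `theorem foo : Summit.AtomisticToContinuum.BoseEinsteinCondensation.Theses.BECSectorPoincare.<Decl> := …` in Summits/AtomisticToContinuum/BoseEinsteinCondensation/Theorems/<Name>.lean.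
-/

namespace Summit.AtomisticToContinuum.BoseEinsteinCondensation.Theses.BECSectorPoincare

open scoped BigOperators Topology Manifold Classical MeasureTheory ProbabilityTheory Matrix InnerProductSpace ComplexConjugate ContinuousMap
open Filter Set Function TopologicalSpace MeasureTheory

attribute [summit_statement] _root_.BoseEinsteinCondensation

/-- item stmt-AtomisticToContinuum-6314 · target · rank 0 · closed · moot by None · by planner
why it might fail: A thermodynamic-limit spectral statement (only MF/GP sector spectra are theorems: Seiringer2011, BoccatoEtAl2019Acta); a soft non-phonon branch or c.o.m. tower inside |k| ≤ M₀√(ρa), or θ→0 with L, kills it (the Jones–Roberts ring branch undercuts c|k| only at |k| ≳ C/a, outside the window).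
sources: Feynman1954, Stringari1995, Seiringer2011, BoccatoEtAl2019Acta, JonesRoberts1982, LiebLiniger1963
[target] X as in § Thesis: linear sector floor θ√(ρa)|k| for all Bloch-k periodic trial states, 2π/L
≤ |k| ≤ M₀√(ρa), density window ρ/2..2ρ, all large N (θ after M₀; hard cores admitted; a = 0 makes
it trivially true). -/
@[route_item "route-AtomisticToContinuum-BECSectorPoincare"]
def LandauSectorBound : Prop :=
  ∀ v : ℝ → ENNReal, Literature.MathematicalPhysics.QuantumManyBody.BoseGas.IsRepulsiveFiniteRange v → ∀ M₀ : ℝ, 0 < M₀ → ∃ θ : ℝ, 0 < θ ∧ ∃ ρ₀ : ℝ, 0 < ρ₀ ∧ ∀ ρ : ℝ, 0 < ρ → ρ < ρ₀ → ∀ᶠ N : ℕ in Filter.atTop, ∀ L : ℝ, 0 < L → ρ / 2 ≤ (N : ℝ) / L ^ 3 → (N : ℝ) / L ^ 3 ≤ 2 * ρ → ∀ m : Fin 3 → ℤ, m ≠ 0 → let a : ℝ := (Literature.MathematicalPhysics.QuantumManyBody.BoseGas.scatteringLength v).toReal; let k : ℝ := 2 * Real.pi / L * ‖(WithLp.toLp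 2 fun t => (m t : ℝ) : EuclideanSpace ℝ (Fin 3))‖; k ≤ M₀ * Real.sqrt (ρ * a) → ∀ Ψ : Literature.MathematicalPhysics.QuantumManyBody.BoseGas.PeriodicTrialState N L, (∀ (X : Literature.MathematicalPhysics.QuantumManyBody.BoseGas.Config N) (s : EuclideanSpace ℝ (Fin 3)), Ψ.ψ (fun j => X j + s) = Complex.exp (Complex.I * ↑(2 * Real.pi / L * ∑ t : Fin 3, (m t : ℝ) * s t)) * Ψ.ψ X) → Literature.MathematicalPhysics.QuantumManyBody.BoseGas.periodicGroundStateEnergy v N L + ENNReal.ofReal (θ * Real.sqrt (ρ * a) * k) ≤ Literature.MathematicalPhysics.QuantumManyBody.BoseGas.periodicEnergy v Ψ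

/-- item stmt-AtomisticToContinuum-6315 · crux · rank 2 · closed · moot by None · by planner
why it might fail: Cross-scale terms for Ψ₀² are as long-ranged as the 1/|k| stiffness itself; S(k) ≤ Ck is only the Gaussian shadow of the coarse convexity actually needed, and conditional block gaps of Ψ₀² are unknown; kill signal: the scheme returns only the global gap ~c/L.
sources: GrunewaldEtAl2009, OttoReznikoff2007, MenzOtto2013, BauerschmidtBodineauDagallier2024, BauerschmidtDagallier2023, LuYau1993
[crux] (card TS + HC, specialised and typed as an implication) for each admissible v:
TorusHyperuniformity's body for v ⇒ LandauSectorBound's body for v — hyperuniformity of the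
near-ground states upgrades, by a SECTOR-RESOLVED two-scale/multiscale Bakry–Émery argument for μ =
Ψ₀² (local dilute-gas block Poincaré at scales ≤ O(ξ), coarse convexity of −log(block-density law)
with modulus ≍ 1/(ρS(k)), Fourier-block-diagonal cross terms), to the linear sector floor:
"Feynman's k²/S(k) is a lower bound up to a constant". [difficulty: open-problem] -/
@[route_item "route-AtomisticToContinuum-BECSectorPoincare"]
def TwoScaleReduction : Prop :=
  ∀ v : ℝ → ENNReal, Literature.MathematicalPhysics.QuantumManyBody.BoseGas.IsRepulsiveFiniteRange v → (∀ M₀ : ℝ, 0 < M₀ → ∃ C : ℝ, 0 < C ∧ ∃ ρ₀ : ℝ, 0 < ρ₀ ∧ ∀ ρ : ℝ, 0 < ρ → ρ < ρ₀ → ∀ᶠ N : ℕ in Filter.atTop, ∀ L : ℝ, 0 < L → ρ / 2 ≤ (N : ℝ) / L ^ 3 → (N : ℝ) / L ^ 3 ≤ 2 * ρ → ∃ δ : ENNReal, 0 < δ ∧ ∀ Ψ : Literature.MathematicalPhysics.QuantumManyBody.BoseGas.PeriodicTrialState N L, Literature.MathematicalPhysics.QuantumManyBody.BoseGas.periodicEnergy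 v Ψ ≤ Literature.MathematicalPhysics.QuantumManyBody.BoseGas.periodicGroundStateEnergy v N L + δ → ∀ m : Fin 3 → ℤ, m ≠ 0 → let a : ℝ := (Literature.MathematicalPhysics.QuantumManyBody.BoseGas.scatteringLength v).toReal; let k : ℝ := 2 * Real.pi / L * ‖(WithLp.toLp 2 fun t => (m t : ℝ) : EuclideanSpace ℝ (Fin 3))‖; k ≤ M₀ * Real.sqrt (ρ * a) → (⨅ c : ℂ, ∫⁻ X in Literature.MathematicalPhysics.QuantumManyBody.BoseGas.cellN N L, (‖(∑ j : Fin N, Complex.exp (Complex.I * ↑(2 * Real.pi / L * ∑ t : Fin 3, (m t : ℝ) * X j t))) - c‖₊ : ENNReal) ^ 2 * (‖Ψ.ψ X‖₊ : ENNReal) ^ 2) ≤ ENNReal.ofReal (C * N * k / Real.sqrt (ρ * a))) → ∀ M₀ : ℝ, 0 < M₀ → ∃ θ : ℝ, 0 < θ ∧ ∃ ρ₀ : ℝ, 0 < ρ₀ ∧ ∀ ρ : ℝ, 0 < ρ → ρ < ρ₀ → ∀ᶠ N : ℕ in Filter.atTop, ∀ L : ℝ, 0 < L → ρ / 2 ≤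 (N : ℝ) / L ^ 3 → (N : ℝ) / L ^ 3 ≤ 2 * ρ → ∀ m : Fin 3 → ℤ, m ≠ 0 → let a : ℝ := (Literature.MathematicalPhysics.QuantumManyBody.BoseGas.scatteringLength v).toReal; let k : ℝ := 2 * Real.pi / L * ‖(WithLp.toLp 2 fun t => (m t : ℝ) : EuclideanSpace ℝ (Fin 3))‖; k ≤ M₀ * Real.sqrt (ρ * a) → ∀ Ψ : Literature.MathematicalPhysics.QuantumManyBody.BoseGas.PeriodicTrialState N L, (∀ (X : Literature.MathematicalPhysics.QuantumManyBody.BoseGas.Config N) (s : EuclideanSpace ℝ (Fin 3)), Ψ.ψ (fun j => X j + s) = Complex.exp (Complex.I * ↑(2 * Real.pi / L * ∑ t : Fin 3, (m t : ℝ) * s t)) * Ψ.ψ X) → Literature.MathematicalPhysics.QuantumManyBody.BoseGas.periodicGroundStateEnergy v N L + ENNReal.ofReal (θ * Real.sqrt (ρ * a) * k) ≤ Literature.MathematicalPhysics.QuantumManyBody.BoseGas.periodicEnergy v Ψ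

/-- item stmt-AtomisticToContinuum-6316 · crux · rank 3 · closed · moot by None · by planner
why it might fail: Uniformity down to |k| = 2π/L for all near-minimisers needs an LHY-precision LOWER bound for H + λΣcos(k·x_i) (static response χ(k) ≤ C/(ρa)) that is not in print; C may need ρ- or M₀-dependence beyond Bogoliubov; the canonical constraint could spoil the lowest shell.
sources: ReattoChester1967, PitaevskiiStringari1991, TorquatoStillinger2003, FournaisSolovej2020, Stringari1995
[crux] (card HC, quantitative half; torus twin of stmt-AtomisticToContinuum-3978) for every
admissible v and M₀ there are C, ρ₀ with: for 0 < ρ < ρ₀, all large N, every L in the density window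
there is δ > 0 such that every δ-near-minimiser Ψ of the periodic energy has Var_(|Ψ|²)(Σ_j
e^(ik·x_j)) ≤ C·N·|k|/√(ρa) for all k = (2π/L)m, m ≠ 0, |k| ≤ M₀√(ρa) (S(k) ≤ C|k|/√(ρa) down to the
lowest mode; Bogoliubov: C → 1/(4√π); necessary for X by Feynman–Bijl). [difficulty: XL] -/
@[route_item "route-AtomisticToContinuum-BECSectorPoincare"]
def TorusHyperuniformity : Prop :=
  ∀ v : ℝ → ENNReal, Literature.MathematicalPhysics.QuantumManyBody.BoseGas.IsRepulsiveFiniteRange v → ∀ M₀ : ℝ, 0 < M₀ → ∃ C : ℝ, 0 < C ∧ ∃ ρ₀ : ℝ, 0 < ρ₀ ∧ ∀ ρ : ℝ, 0 < ρ → ρ < ρ₀ → ∀ᶠ N : ℕ in Filter.atTop, ∀ L : ℝ, 0 < L → ρ / 2 ≤ (N : ℝ) / L ^ 3 → (N : ℝ) / L ^ 3 ≤ 2 * ρ → ∃ δ : ENNReal, 0 < δ ∧ ∀ Ψ : Literature.MathematicalPhysics.QuantumManyBody.BoseGas.PeriodicTrialState N L, Literature.MathematicalPhysics.QuantumManyBody.BoseGas.periodicEnergy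 v Ψ ≤ Literature.MathematicalPhysics.QuantumManyBody.BoseGas.periodicGroundStateEnergy v N L + δ → ∀ m : Fin 3 → ℤ, m ≠ 0 → let a : ℝ := (Literature.MathematicalPhysics.QuantumManyBody.BoseGas.scatteringLength v).toReal; let k : ℝ := 2 * Real.pi / L * ‖(WithLp.toLp 2 fun t => (m t : ℝ) : EuclideanSpace ℝ (Fin 3))‖; k ≤ M₀ * Real.sqrt (ρ * a) → (⨅ c : ℂ, ∫⁻ X in Literature.MathematicalPhysics.QuantumManyBody.BoseGas.cellN N L, (‖(∑ j : Fin N, Complex.exp (Complex.I * ↑(2 * Real.pi / L * ∑ t : Fin 3, (m t : ℝ) * X j t))) - c‖₊ : ENNReal) ^ 2 * (‖Ψ.ψ X‖₊ : ENNReal) ^ 2) ≤ ENNReal.ofReal (C * N * k / Real.sqrt (ρ * a))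

/-- item stmt-AtomisticToContinuum-0827 · crux · rank 5 · open · by planner
why it might fail: PeriodicBEC(v) is ground-state-only at the box (N/ρ)^(1/3): the Dirichlet ground state lies a wall term ≫ δ above E₀^per and interior restrictions are neither periodic nor of sharp N, so the hypothesis may never fire; BEC is BC-sensitive (Robinson1976).
sources: LSSY2005, Basti2022, BoccatoSeiringer2023, Junge2026, Robinson1976, LauwersVerbeureZagrebnov2003
[crux] BoundaryTransferWeak (mode-free boundary-condition transfer, per potential): for each
repulsive finite-range v, PeriodicBEC(v) implies ∃ρ₀>0 ∀ρ∈(0,ρ₀) HasGroundStateBEC v ρ (Dirichlet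
ground state, λ_max(γ) ≥ cN via condensateNumber). Not glue: near-minimiser slacks are O(N/L²) while
Dirichlet/periodic energies differ by a boundary term ≫ N/L², so no energy-comparison proof;
expected route: Neumann bracketing of interior sub-boxes (−Δ_Dir ≥ ⊕−Δ_Neu, v ≥ 0) + a mode-free
criterion (λ_max ≥ tr γ²/N). Only the ENERGY analogue is in print (LiebSeiringerSolovejYngvason2005
Ch. 2 after (2.8)). v ≡ 0: hypothesis and conclusion both true. -/
@[route_item "route-AtomisticToContinuum-BECSectorPoincare"]
def BoundaryTransferWeak : Prop :=
  ∀ v : ℝ → ENNReal, Literature.MathematicalPhysics.QuantumManyBody.BoseGas.IsRepulsiveFiniteRange v → (∃ ρ₀ : ℝ, 0 < ρ₀ ∧ ∀ ρ : ℝ, 0 < ρ → ρ < ρ₀ → ∃ c : ℝ, 0 < c ∧ ∀ᶠ N : ℕ in Filter.atTop, ∃ δ : ENNReal, 0 < δ ∧ ∀ Ψ : Literature.MathematicalPhysics.QuantumManyBody.BoseGas.PeriodicTrialState N (Literature.MathematicalPhysics.QuantumManyBody.BoseGas.sideLength ρ N), Literature.MathematicalPhysics.QuantumManyBody.BoseGas.periodicEnergy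 v Ψ ≤ Literature.MathematicalPhysics.QuantumManyBody.BoseGas.periodicGroundStateEnergy v N (Literature.MathematicalPhysics.QuantumManyBody.BoseGas.sideLength ρ N) + δ → ENNReal.ofReal (c * N) ≤ Literature.MathematicalPhysics.QuantumManyBody.BoseGas.condensateOccupation N (Literature.MathematicalPhysics.QuantumManyBody.BoseGas.sideLength ρ N) Ψ.ψ) → ∃ ρ₀ : ℝ, 0 < ρ₀ ∧ ∀ ρ : ℝ, 0 < ρ → ρ < ρ₀ → Literature.MathematicalPhysics.QuantumManyBody.BoseGas.HasGroundStateBEC v ρ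

/-- item stmt-AtomisticToContinuum-6318 · crux · rank 6 · closed · moot by None · by planner
why it might fail: No proof of convexity of N ↦ E₀(N,L) at fixed L is known for continuum bosons (LHY-precision asymptotics FournaisSolovej2020/LSSY2005 miss second differences by orders); packing/commensurability could make increments non-monotone for hard cores before the dilute asymptotics set in.
sources: LSSY2005, FournaisSolovej2020, LiebLiniger1963, BoccatoEtAl2019
[crux] (needed by the moment bound because a_k changes N) near-convexity of the canonical torus
energy in N in the dilute window: for each admissible v there is ρ₁ such that for every ε > 0, 0 < ρ
< ρ₁, all large N and L in the density window, 2E₀^per(N,L) ≤ E₀^per(N+1,L) + E₀^per(N−1,L) +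
ε√(ρa)/L (expected: second difference = +8πa/L³(1+o(1)) ≥ 0, allowance ε√(ρa)/L ≫ a/L³).
[difficulty: M] -/
@[route_item "route-AtomisticToContinuum-BECSectorPoincare"]
def EnergyConvexityWindow : Prop :=
  ∀ v : ℝ → ENNReal, Literature.MathematicalPhysics.QuantumManyBody.BoseGas.IsRepulsiveFiniteRange v → ∃ ρ₁ : ℝ, 0 < ρ₁ ∧ ∀ ε : ℝ, 0 < ε → ∀ ρ : ℝ, 0 < ρ → ρ < ρ₁ → ∀ᶠ N : ℕ in Filter.atTop, ∀ L : ℝ, 0 < L → ρ / 2 ≤ (N : ℝ) / L ^ 3 → (N : ℝ) / L ^ 3 ≤ 2 * ρ → 2 * Literature.MathematicalPhysics.QuantumManyBody.BoseGas.periodicGroundStateEnergy v N L ≤ Literature.MathematicalPhysics.QuantumManyBody.BoseGas.periodicGroundStateEnergy v (N + 1) L + Literature.MathematicalPhysics.QuantumManyBody.BoseGas.periodicGroundStateEnergy v (N - 1) L + ENNReal.ofReal (ε * Real.sqrt (ρ * (Literature.MathematicalPhysics.QuantumManyBody.BoseGas.scatteringLength v).toReal) / L)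

/-- item stmt-AtomisticToContinuum-6317 · support · rank 4 · closed · moot by None · by planner
why it might fail: For hard cores (admissible!) v̂(0) = ∞ and the double commutator is infinite — needs a Dyson/Jastrow-dressed a_k or a softening uniform in N; the ground state must be produced from C¹ near-minimisers (compactness, uniqueness, P = 0) inside the operator-free setting.
sources: Wagner1966, Stringari1995, PitaevskiiStringari1991, Roepstorff1978, LSSY2005
[crux] (bridge; card BR = card sector-gap-no-cheap-momentum N2+N3 with the N±1 correction) for each
admissible v: EnergyConvexityWindow's body for v ⇒ LandauSectorBound's body for v ⇒ PeriodicBEC's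
body for v (stmt-0826): the Wagner–Feynman moment bound n_k(ω_(N−1)(k) + ω_(N+1)(k) + μ⁺ − μ⁻) ≤
⟨[a_k,[H,a_k†]]⟩ ≤ k² + 2ρv̂(0) for the torus ground state (P = 0 by uniqueness/positivity), the
floor at N±1 in the same box (density window), near-convexity to absorb μ⁺ − μ⁻, kinetic Chebyshev
above K = M₀√(ρa) with M₀² ≥ 2v̂(0)/a and E₀ ≤ ½ρv̂(0)N, the d = 3 count
Σ_(0<|k|≤K)(k²+2ρv̂)/(θ√(ρa)|k|) ≤ C√(ρa³)N, then transfer to δ-near-minimisers at fixed (N,L); c =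
1/2. [deps: LandauSectorBound, EnergyConvexityWindow] [difficulty: L] -/
@[route_item "route-AtomisticToContinuum-BECSectorPoincare"]
def LandauToPeriodicBEC : Prop :=
  ∀ v : ℝ → ENNReal, Literature.MathematicalPhysics.QuantumManyBody.BoseGas.IsRepulsiveFiniteRange v → (∃ ρ₁ : ℝ, 0 < ρ₁ ∧ ∀ ε : ℝ, 0 < ε → ∀ ρ : ℝ, 0 < ρ → ρ < ρ₁ → ∀ᶠ N : ℕ in Filter.atTop, ∀ L : ℝ, 0 < L → ρ / 2 ≤ (N : ℝ) / L ^ 3 → (N : ℝ) / L ^ 3 ≤ 2 * ρ → 2 * Literature.MathematicalPhysics.QuantumManyBody.BoseGas.periodicGroundStateEnergy v N L ≤ Literature.MathematicalPhysics.QuantumManyBody.BoseGas.periodicGroundStateEnergy v (N + 1) L + Literature.MathematicalPhysics.QuantumManyBody.BoseGas.periodicGroundStateEnergy v (N - 1) L + ENNReal.ofReal (ε * Real.sqrt (ρ * (Literature.MathematicalPhysics.QuantumManyBody.BoseGas.scatteringLength v).toReal) / L)) → (∀ M₀ : ℝ, 0 < M₀ → ∃ θ : ℝ, 0 < θ ∧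 ∃ ρ₀ : ℝ, 0 < ρ₀ ∧ ∀ ρ : ℝ, 0 < ρ → ρ < ρ₀ → ∀ᶠ N : ℕ in Filter.atTop, ∀ L : ℝ, 0 < L → ρ / 2 ≤ (N : ℝ) / L ^ 3 → (N : ℝ) / L ^ 3 ≤ 2 * ρ → ∀ m : Fin 3 → ℤ, m ≠ 0 → let a : ℝ := (Literature.MathematicalPhysics.QuantumManyBody.BoseGas.scatteringLength v).toReal; let k : ℝ := 2 * Real.pi / L * ‖(WithLp.toLp 2 fun t => (m t : ℝ) : EuclideanSpace ℝ (Fin 3))‖; k ≤ M₀ * Real.sqrt (ρ * a) → ∀ Ψ : Literature.MathematicalPhysics.QuantumManyBody.BoseGas.PeriodicTrialState N L, (∀ (X : Literature.MathematicalPhysics.QuantumManyBody.BoseGas.Config N) (s : EuclideanSpace ℝ (Fin 3)), Ψ.ψ (fun j => X j + s) = Complex.exp (Complex.I * ↑(2 * Real.pi / L * ∑ t : Fin 3, (m t : ℝ) * s t)) * Ψ.ψ X) → Literature.MathematicalPhysics.QuantumManyBody.BoseGas.periodicGroundStateEnergy v N L + ENNReal.ofReal (θ * Real.sqrt (ρ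 * a) * k) ≤ Literature.MathematicalPhysics.QuantumManyBody.BoseGas.periodicEnergy v Ψ) → ∃ ρ₀ : ℝ, 0 < ρ₀ ∧ ∀ ρ : ℝ, 0 < ρ → ρ < ρ₀ → ∃ c : ℝ, 0 < c ∧ ∀ᶠ N : ℕ in Filter.atTop, ∃ δ : ENNReal, 0 < δ ∧ ∀ Ψ : Literature.MathematicalPhysics.QuantumManyBody.BoseGas.PeriodicTrialState N (Literature.MathematicalPhysics.QuantumManyBody.BoseGas.sideLength ρ N), Literature.MathematicalPhysics.QuantumManyBody.BoseGas.periodicEnergy v Ψ ≤ Literature.MathematicalPhysics.QuantumManyBody.BoseGas.periodicGroundStateEnergy v N (Literature.MathematicalPhysics.QuantumManyBody.BoseGas.sideLength ρ N) + δ → ENNReal.ofReal (c * N) ≤ Literature.MathematicalPhysics.QuantumManyBody.BoseGas.condensateOccupation N (Literature.MathematicalPhysics.QuantumManyBody.BoseGas.sideLength ρ N) Ψ.ψ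

/-- item stmt-AtomisticToContinuum-0851 · support · rank 9 · closed · moot by None · by planner
sources: LSSY2005
[support] ScatteringLengthFinite: finite range R₀ ⇒ scatteringLength v ≠ ⊤ (indeed a ≤ R₀+ε: trial φ
∈ C¹, φ = 0 on B_{R₀}, φ = 1 off B_{R₀+ε}, so v·φ² = 0 incl. hard cores since ⊤·0 = 0).
[LiebSeiringerSolovejYngvason2005 App. C, Thm C.1 and Remark; scatteringLength_le] -/
@[route_item "route-AtomisticToContinuum-BECSectorPoincare"]
def ScatteringLengthFinite : Prop :=
  ∀ v : ℝ → ENNReal, Literature.MathematicalPhysics.QuantumManyBody.BoseGas.IsRepulsiveFiniteRange v → Literature.MathematicalPhysics.QuantumManyBody.BoseGas.scatteringLength v ≠ ⊤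

/-- item stmt-AtomisticToContinuum-6319 · support · rank 9 · closed · moot by None · by planner
sources: BoccatoEtAl2019Acta, BoccatoEtAl2019, LSSY2005, NamEtAl2022
[support] (card LB, torus shadow; calibration of the local input) for every admissible v and M there
are θ, ℓ₀ with: for ℓ ≥ ℓ₀ and n·a ≤ M²ℓ (Gross–Pitaevskii window and below), every Bloch-k periodic
trial state of n particles on the torus of side ℓ, k ≠ 0, has periodicEnergy ≥ E₀^per(n,ℓ) + θ/ℓ²
(Bogoliubov: gap ≈ √((2π)⁴ + 16π(na/ℓ)(2π)²)/ℓ²; a corollary of the BBCS spectrum for V ∈ L³ at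
fixed na/ℓ, plus n₊ ≥ 1 on k ≠ 0 sectors; open for hard cores). [difficulty: L] -/
@[route_item "route-AtomisticToContinuum-BECSectorPoincare"]
def GPWindowSectorGap : Prop :=
  ∀ v : ℝ → ENNReal, Literature.MathematicalPhysics.QuantumManyBody.BoseGas.IsRepulsiveFiniteRange v → ∀ M : ℝ, 0 < M → ∃ θ : ℝ, 0 < θ ∧ ∃ ℓ₀ : ℝ, ∀ ℓ : ℝ, ℓ₀ ≤ ℓ → 0 < ℓ → ∀ n : ℕ, (n : ℝ) * (Literature.MathematicalPhysics.QuantumManyBody.BoseGas.scatteringLength v).toReal ≤ M ^ 2 * ℓ → ∀ m : Fin 3 → ℤ, m ≠ 0 → ∀ Ψ : Literature.MathematicalPhysics.QuantumManyBody.BoseGas.PeriodicTrialState n ℓ, (∀ (X : Literature.MathematicalPhysics.QuantumManyBody.BoseGas.Config n) (s : EuclideanSpace ℝ (Fin 3)), Ψ.ψ (fun j => X j + s) = Complex.exp (Complex.I * ↑(2 * Real.pi / ℓ * ∑ t : Fin 3, (m t : ℝ) * s t)) * Ψ.ψ X) → Literature.MathematicalPhysics.QuantumManyBody.BoseGas.periodicGroundStateEnergy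 v n ℓ + ENNReal.ofReal (θ / ℓ ^ 2) ≤ Literature.MathematicalPhysics.QuantumManyBody.BoseGas.periodicEnergy v Ψ

/-- item stmt-AtomisticToContinuum-7675 · support · rank 9 · closed · moot by None · by planner
sources: LSSY2005, Stringari1995
[support] (glue, junction with route-AtomisticToContinuum-BECSectorGap) for each admissible v:
EnergyConvexityWindow's body → LandauSectorBound's body → the tail of BECSectorGap.SectorGapFloor
(stmt-5149: ∫v ≠ 0 → ∀ C > 0 ∃ κ, ρ₀: Γ_N(k) = E^per_(N+1)(k;L) + E^per_(N−1)(k;L) − 2E₀^per(N,L) ≥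
2κ‖k‖² for k ≠ 0, ‖k‖² ≤ Cρ, L = (N/ρ)^(1/3)); proof: 0 < a < ∞, M₀ := √(C/a), κ := θ√(a/C)/2, empty
Bloch classes off the dual lattice, the Landau body at N±1 in the same box, near-convexity with ε :=
πθ. [difficulty: provable-now] -/
@[route_item "route-AtomisticToContinuum-BECSectorPoincare", crux]
def LandauFloorToSectorGap : Prop :=
  ∀ v : ℝ → ENNReal, Literature.MathematicalPhysics.QuantumManyBody.BoseGas.IsRepulsiveFiniteRange v → (∃ ρ₁ : ℝ, 0 < ρ₁ ∧ ∀ ε : ℝ, 0 < ε → ∀ ρ : ℝ, 0 < ρ → ρ < ρ₁ → ∀ᶠ N : ℕ in Filter.atTop, ∀ L : ℝ, 0 < L → ρ / 2 ≤ (N : ℝ) / L ^ 3 → (N : ℝ) / L ^ 3 ≤ 2 * ρ → 2 * Literature.MathematicalPhysics.QuantumManyBody.BoseGas.periodicGroundStateEnergy v N L ≤ Literature.MathematicalPhysics.QuantumManyBody.BoseGas.periodicGroundStateEnergy v (N + 1) L + Literature.MathematicalPhysics.QuantumManyBody.BoseGas.periodicGroundStateEnergy v (N - 1) L + ENNReal.ofReal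 (ε * Real.sqrt (ρ * (Literature.MathematicalPhysics.QuantumManyBody.BoseGas.scatteringLength v).toReal) / L)) → (∀ M₀ : ℝ, 0 < M₀ → ∃ θ : ℝ, 0 < θ ∧ ∃ ρ₀ : ℝ, 0 < ρ₀ ∧ ∀ ρ : ℝ, 0 < ρ → ρ < ρ₀ → ∀ᶠ N : ℕ in Filter.atTop, ∀ L : ℝ, 0 < L → ρ / 2 ≤ (N : ℝ) / L ^ 3 → (N : ℝ) / L ^ 3 ≤ 2 * ρ → ∀ m : Fin 3 → ℤ, m ≠ 0 → let a : ℝ := (Literature.MathematicalPhysics.QuantumManyBody.BoseGas.scatteringLength v).toReal; let k : ℝ := 2 * Real.pi / L * ‖(WithLp.toLp 2 fun t => (m t : ℝ) : EuclideanSpace ℝ (Fin 3))‖; k ≤ M₀ * Real.sqrt (ρ * a) → ∀ Ψ : Literature.MathematicalPhysics.QuantumManyBody.BoseGas.PeriodicTrialState N L, (∀ (X : Literature.MathematicalPhysics.QuantumManyBody.BoseGas.Config N) (s : EuclideanSpace ℝ (Fin 3)), Ψ.ψ (fun j => X j + s) = Complex.exp (Complex.I * ↑(2 * Real.pi / L *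 ∑ t : Fin 3, (m t : ℝ) * s t)) * Ψ.ψ X) → Literature.MathematicalPhysics.QuantumManyBody.BoseGas.periodicGroundStateEnergy v N L + ENNReal.ofReal (θ * Real.sqrt (ρ * a) * k) ≤ Literature.MathematicalPhysics.QuantumManyBody.BoseGas.periodicEnergy v Ψ) → (∫⁻ x : EuclideanSpace ℝ (Fin 3), v ‖x‖) ≠ 0 → ∀ C : ℝ, 0 < C → ∃ κ : ℝ, 0 < κ ∧ ∃ ρ₀ : ℝ, 0 < ρ₀ ∧ ∀ ρ : ℝ, 0 < ρ → ρ < ρ₀ → ∀ᶠ N : ℕ in Filter.atTop, ∀ k : EuclideanSpace ℝ (Fin 3), k ≠ 0 → ‖k‖ ^ 2 ≤ C * ρ → 2 * Literature.MathematicalPhysics.QuantumManyBody.BoseGas.periodicGroundStateEnergy v N (Literature.MathematicalPhysics.QuantumManyBody.BoseGas.sideLength ρ N) + ENNReal.ofReal (2 * κ * ‖k‖ ^ 2) ≤ (⨅ (Ψ : Literature.MathematicalPhysics.QuantumManyBody.BoseGas.PeriodicTrialState (N + 1) (Literature.MathematicalPhysics.QuantumManyBody.BoseGas.sideLength ρ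 N)) (_ : ∀ (s : EuclideanSpace ℝ (Fin 3)) (X : Fin (N + 1) → EuclideanSpace ℝ (Fin 3)), Ψ.ψ (fun i => X i + s) = Complex.exp (Complex.I * ↑(∑ j, k j * s j)) * Ψ.ψ X), Literature.MathematicalPhysics.QuantumManyBody.BoseGas.periodicEnergy v Ψ) + (⨅ (Ψ : Literature.MathematicalPhysics.QuantumManyBody.BoseGas.PeriodicTrialState (N - 1) (Literature.MathematicalPhysics.QuantumManyBody.BoseGas.sideLength ρ N)) (_ : ∀ (s : EuclideanSpace ℝ (Fin 3)) (X : Fin (N - 1) → EuclideanSpace ℝ (Fin 3)), Ψ.ψ (fun i => X i + s) = Complex.exp (Complex.I * ↑(∑ j, k j * s j)) * Ψ.ψ X), Literature.MathematicalPhysics.QuantumManyBody.BoseGas.periodicEnergy v Ψ)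

/-- item stmt-AtomisticToContinuum-6320 · assembly · rank 1 · closed · moot by None · by planner
sources: LSSY2005, Stringari1995
[assembly] TwoScaleReduction → TorusHyperuniformity → EnergyConvexityWindow → LandauToPeriodicBEC →
BoundaryTransferWeak → BoseEinsteinCondensation. -/
@[route_item "route-AtomisticToContinuum-BECSectorPoincare"]
def Assembly : Prop :=
  TwoScaleReduction → TorusHyperuniformity → EnergyConvexityWindow → LandauToPeriodicBEC → BoundaryTransferWeak → Literature.MathematicalPhysics.QuantumManyBody.BoseGas.BoseEinsteinCondensation

end Summit.AtomisticToContinuum.BoseEinsteinCondensation.Theses.BECSectorPoincare
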